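import Summits.RiemannHypothesis.RiemannHypothesis.Theorems.UniversalFactorMediumHighCover

/-!
# RiemannHypothesis / UniversalFactor — `MediumKernelNoGo`, high window 2: the compiled certificate

Route `RiemannHypothesis/UniversalFactor`, crux `MediumKernelNoGo` (stmt-RiemannHypothesis-2577), line
`one-sided-average-sign-test`, stub `stub_highWindow`.  The window check `hiRun 20 38 35 As 1000`
(cells of half-width 1/20, 38 backward and 35 forward cells at `t₀ = 7005.08`, boxes
`As/1000 = [4000, 6000, 10000, 16000, 22000, 27000, 32000]`) is evaluated ONCE by `native_decide` (a certified computation: the certified `ζ`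
evaluator at the 1168 Gauss–Legendre nodes, then interval re-weighting per box), and
`hiRunWith_sound` turns it into the dip certificate `H_0(x₀) < 0 < P_a(x₀), Q_a(x₀)`, `x₀ = 2t₀`, for every
`a ∈ [3 / 2, 32]`.
-/

set_option linter.dupNamespace false

namespace Summit.RiemannHypothesis.RiemannHypothesis.Theorems

open Set MeasureTheory
open Literature.NumberTheory.LFunctions Literature.NumberTheory.LFunctions.ZetaNumerics

/-- The breakpoints of window 2 (over `1000`). [folklore] -/
def UniversalFactor.hiAs2 : List ℕ := [4000, 6000, 10000, 16000, 22000, 27000, 32000]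

/-- **The compiled check of window 2.** [folklore] -/
theorem UniversalFactor.hiWin2_check : UniversalFactor.hiRun 20 38 35 UniversalFactor.hiAs2 1000 = true := by
  native_decide

/-- **Window 2 of `stub_highWindow`**: the dip certificate at `x₀ = 2t₀` for `3 / 2 ≤ a ≤ 32`. [folklore] -/
theorem UniversalFactor.stub_highWindow2 : ∀ a : ℝ, (4 : ℝ) ≤ a → a ≤ 32 →
    (deBruijnH 0 ((2 * UniversalFactor.lehmerT0 : ℝ) : ℂ)).re < 0 ∧
      0 < (∫ y in Ioi (0:ℝ), deBruijnH 0 (((2 * UniversalFactor.lehmerT0 : ℝ) : ℂ) - y) * (Real.exp (-(a * y)) : ℂ)).re ∧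
      0 < (∫ y in Ioi (0:ℝ), deBruijnH 0 (((2 * UniversalFactor.lehmerT0 : ℝ) : ℂ) + y) * (Real.exp (-(a * y)) : ℂ)).re :=
  fun a h1 h2 =>
    UniversalFactor.hiRunWith_sound (oT := UniversalFactor.lehmerTables)
      (fun T hT => by unfold UniversalFactor.lehmerTables at hT; exact mkTables_valid hT)
      UniversalFactor.hiWin2_check
      (by simp only [UniversalFactor.hiAs2, List.getD_cons_zero]; push_cast; linarith)
      (by simp only [UniversalFactor.hiAs2, List.length_cons, List.length_nil, List.getD_cons_succ, List.getD_cons_zero]; push_cast; linarith)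

end Summit.RiemannHypothesis.RiemannHypothesis.Theorems
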